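import Summits.Ventures.Crystal3D.Theorems.StickyWulffConstantGenericWallFloorTubeWalkChain
import Summits.Ventures.Crystal3D.Theorems.StickyWulffConstantGenericWallFloorPlateClimb
import Summits.Ventures.Crystal3D.Theorems.StickyWulffConstantGenericWallFloorCredits
import Mathlib.Algebra.Order.BigOperators.Group.Finset
import HarnessLib

/-!
# Counting the tubes for CHAIN pairs: payers with fibres `O(1 + h)`

HONEST FRAMING. Venture `Summits/Ventures/Crystal3D` (cell `crystal3d-full`), helper for the crux
`GenericWallFloor` (stmt-Ventures-19480) of `route-Ventures-StickyWulffConstant`, REGISTERED line `WallLedgerG`,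
open stub `stub_twoSlabAdhesion` (general fillings; ARCH v4 «coherent walks in tubes» extended to the `Σ3ⁿ`
chain pairs, assembly step).  Rung credit only; F-C1 not moved.

`card_chainPayers_ge_sf`.  Two-slab cell (bottom window `P₁` complete on `Λ₁ = A₁·Λ₀ + t₁`, top window
`P₂` complete on `Λ₂ = A₂·Λ₀ + t₂`), inputs `KissingGap δ` / `KissingClassification δ` BY NAME.  TERMINAL
CLASS: a set `𝓣` of frames containing every `G` with `G(Λ₀) = A₂(Λ₀)`, closed under the HORIZONTAL menu
mirrors, NOT containing `A₁`, and a TILT MODULUS `δ₀ > 0` with `δ₀ ≤ (√3/2)√(1 − ⟪n, e₃⟫²)` for every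
non-horizontal unit menu normal `n` of a frame of `𝓣` (for the concrete class «`A₂(Λ₀)` or its horizontal
twin» these are discharged in the next file from non-co-axiality; `δ₀` depends on `A₂` only).  Let `K : ℕ`
with `h + 3R₀ + 3 ≤ K·δ₀` and `m : ℕ` with `2·(37m)² ≤ (ρ − 23 − K)²`.  Then
`(2m + 1)² ≤ (169 K + 170) · #{x ∈ X : deg x ≠ 12, −R₀ − 2 ≤ x₂ ≤ h + R₀ + 4}`.
Proof: every axis `(37 i, 37 j)`, `|i|, |j| ≤ m`, gets a payer: directly from `tube_chain_sf` (a), or in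
case (b) — a terminal twin dozen `e` of a frame `G ∉ 𝓣` whose mirror frame is in `𝓣`, so its normal is
tilted (horizontal-mirror closure) with modulus `δ₀`, and `G(Λ₀) ≠ A₂(Λ₀)` — from `twinDozen_plateClimb_payer`
within `K` plate steps.  Direct payers determine their axis (`37 > 2·18`); a climb payer `z` determines the
terminal ball `e = y⋆ − k·(y⋆ − y')` up to the choice of `y⋆ ∈ X` with `z = y⋆ ∨ dist y⋆ z = 1` (`≤ 13`,
kissing number), of `y' ∈ X` equal or adjacent to `y⋆` (`≤ 13`) and of `k ≤ K`; `e` determines the axis.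
So every payer is used by at most `1 + 169 (K + 1)` axes.
WHAT THIS IS NOT: not the stub; the ledger bookkeeping and the discharge of `𝓣`, `δ₀` remain; F-C1 not moved.
-/

noncomputable section

namespace Summit.Ventures.Crystal3D.Theorems

open Summit.Ventures.Crystal3D Finset
open Literature.MathematicalPhysics.StatisticalMechanics (fccStacking)
open scoped InnerProductSpace

/-- Two axes of the `37`-grid within horizontal distance `18` of one point coincide. -/
theorem grid37_axis_unique (u : EuclideanSpace ℝ (Fin 3)) (ij ij' : ℤ × ℤ)
    (h1 : (u 0 - 37 * (ij.1 : ℝ)) ^ 2 + (u 1 - 37 * (ij.2 : ℝ)) ^ 2 ≤ 18 ^ 2)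
    (h2 : (u 0 - 37 * (ij'.1 : ℝ)) ^ 2 + (u 1 - 37 * (ij'.2 : ℝ)) ^ 2 ≤ 18 ^ 2) : ij = ij' := by
  have a0 : |u 0 - 37 * (ij.1 : ℝ)| ≤ 18 := by
    refine abs_le.2 ⟨?_, ?_⟩ <;> nlinarith [sq_nonneg (u 0 - 37 * (ij.1 : ℝ) + 18),
      sq_nonneg (u 0 - 37 * (ij.1 : ℝ) - 18), sq_nonneg (u 1 - 37 * (ij.2 : ℝ))]
  have b0 : |u 0 - 37 * (ij'.1 : ℝ)| ≤ 18 := by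
    refine abs_le.2 ⟨?_, ?_⟩ <;> nlinarith [sq_nonneg (u 0 - 37 * (ij'.1 : ℝ) + 18),
      sq_nonneg (u 0 - 37 * (ij'.1 : ℝ) - 18), sq_nonneg (u 1 - 37 * (ij'.2 : ℝ))]
  have a1 : |u 1 - 37 * (ij.2 : ℝ)| ≤ 18 := by
    refine abs_le.2 ⟨?_, ?_⟩ <;> nlinarith [sq_nonneg (u 1 - 37 * (ij.2 : ℝ) + 18),
      sq_nonneg (u 1 - 37 * (ij.2 : ℝ) - 18), sq_nonneg (u 0 - 37 * (ij.1 : ℝ))]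
  have b1 : |u 1 - 37 * (ij'.2 : ℝ)| ≤ 18 := by
    refine abs_le.2 ⟨?_, ?_⟩ <;> nlinarith [sq_nonneg (u 1 - 37 * (ij'.2 : ℝ) + 18),
      sq_nonneg (u 1 - 37 * (ij'.2 : ℝ) - 18), sq_nonneg (u 0 - 37 * (ij'.1 : ℝ))]
  have e1 : ij.1 = ij'.1 := by
    have : |((ij.1 - ij'.1 : ℤ) : ℝ)| < 1 := by
      push_cast
      have := abs_sub_le (37 * (ij.1 : ℝ)) (u 0) (37 * (ij'.1 : ℝ))
      rw [abs_sub_comm] at a0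
      have h37 : |37 * (ij.1 : ℝ) - 37 * (ij'.1 : ℝ)| = 37 * |(ij.1 : ℝ) - ij'.1| := by
        rw [← mul_sub, abs_mul]; norm_num
      have : 37 * |(ij.1 : ℝ) - ij'.1| ≤ 36 := by linarith
      linarith
    have hz : (ij.1 - ij'.1 : ℤ) = 0 := Int.abs_lt_one_iff.1 (by exact_mod_cast this)
    omega
  have e2 : ij.2 = ij'.2 := by
    have : |((ij.2 - ij'.2 : ℤ) : ℝ)| < 1 := by
      push_cast
      have := abs_sub_le (37 * (ij.2 : ℝ)) (u 1) (37 * (ij'.2 : ℝ))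
      rw [abs_sub_comm] at a1
      have h37 : |37 * (ij.2 : ℝ) - 37 * (ij'.2 : ℝ)| = 37 * |(ij.2 : ℝ) - ij'.2| := by
        rw [← mul_sub, abs_mul]; norm_num
      have : 37 * |(ij.2 : ℝ) - ij'.2| ≤ 36 := by linarith
      linarith
    have hz : (ij.2 - ij'.2 : ℤ) = 0 := Int.abs_lt_one_iff.1 (by exact_mod_cast this)
    omega
  exact Prod.ext e1 e2

open scoped Classical in
/-- At most thirteen balls of a `1`-separated configuration are equal or adjacent to a given point. -/
theorem card_filter_eq_or_dist_eq_one_le (X : Finset (EuclideanSpace ℝ (Fin 3)))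
    (hX : ∀ p ∈ X, ∀ q ∈ X, p ≠ q → 1 ≤ dist p q) (z : EuclideanSpace ℝ (Fin 3)) :
    (X.filter fun y => y = z ∨ dist z y = 1).card ≤ 13 := by
  have hsub : (X.filter fun y => y = z ∨ dist z y = 1) ⊆ insert z (X.filter fun q => dist z q = 1) := by
    intro y hy
    rw [mem_filter] at hy
    rw [mem_insert, mem_filter]
    rcases hy.2 with h | h
    · exact Or.inl h
    · exact Or.inr ⟨hy.1, h⟩
  refine (card_le_card hsub).trans ((card_insert_le _ _).trans ?_)
  have := card_filter_dist_eq_one_le_twelve X hX z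
  omega

open scoped Classical in
/-- **Tube count for chain pairs.**  See the module docstring. -/
theorem card_chainPayers_ge_sf {δ : ℝ} (hg : KissingGap δ) (hc : KissingClassification δ)
    (X : Finset (EuclideanSpace ℝ (Fin 3))) (hX : ∀ p ∈ X, ∀ q ∈ X, p ≠ q → 1 ≤ dist p q)
    (A₁ : EuclideanSpace ℝ (Fin 3) ≃ₗᵢ[ℝ] EuclideanSpace ℝ (Fin 3)) (t₁ : EuclideanSpace ℝ (Fin 3))
    (A₂ : EuclideanSpace ℝ (Fin 3) ≃ₗᵢ[ℝ] EuclideanSpace ℝ (Fin 3)) (t₂ : EuclideanSpace ℝ (Fin 3))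
    (P₁ P₂ : Finset (EuclideanSpace ℝ (Fin 3))) (R₀ h ρ : ℝ) (hR₀ : 3 ≤ R₀) (hρ : R₀ ≤ ρ)
    (hh : 0 ≤ h) (hP₁X : P₁ ⊆ X) (hP₂X : P₂ ⊆ X) (hcell : ∀ p ∈ X, p 2 ≤ h + 2 * R₀)
    (hP₁ : ∀ p, p ∈ P₁ ↔ (p ∈ (fun q => A₁ q + t₁) '' fccStacking 1 (Real.sqrt (2 / 3)) ∧
      -(2 * R₀) ≤ p 2 ∧ p 2 ≤ -R₀ ∧ p 0 ^ 2 + p 1 ^ 2 ≤ ρ ^ 2))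
    (hP₂ : ∀ p, p ∈ P₂ ↔ (p ∈ (fun q => A₂ q + t₂) '' fccStacking 1 (Real.sqrt (2 / 3)) ∧
      h + R₀ ≤ p 2 ∧ p 2 ≤ h + 2 * R₀ ∧ p 0 ^ 2 + p 1 ^ 2 ≤ ρ ^ 2))
    (𝓣 : Set (EuclideanSpace ℝ (Fin 3) ≃ₗᵢ[ℝ] EuclideanSpace ℝ (Fin 3))) (hA₁ : A₁ ∉ 𝓣)
    (hT : ∀ G : EuclideanSpace ℝ (Fin 3) ≃ₗᵢ[ℝ] EuclideanSpace ℝ (Fin 3),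
      G '' fccStacking 1 (Real.sqrt (2 / 3)) = A₂ '' fccStacking 1 (Real.sqrt (2 / 3)) → G ∈ 𝓣)
    (hTh : ∀ G ∈ 𝓣, ∀ n : EuclideanSpace ℝ (Fin 3), ‖n‖ = 1 →
      ⟪n, EuclideanSpace.single (2 : Fin 3) (1 : ℝ)⟫_ℝ ^ 2 = 1 →
      (∀ w ∈ fccSlots, ⟪G w, n⟫_ℝ = 0 ∨ ⟪G w, n⟫_ℝ = Real.sqrt (2 / 3) ∨ ⟪G w, n⟫_ℝ = -Real.sqrt (2 / 3)) →
      ∀ G' : EuclideanSpace ℝ (Fin 3) ≃ₗᵢ[ℝ] EuclideanSpace ℝ (Fin 3),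
        (∀ x, G' x = G x - (2 * ⟪G x, n⟫_ℝ) • n) → G' ∈ 𝓣)
    {δ₀ : ℝ} (hδ₀ : 0 < δ₀)
    (hδ : ∀ G ∈ 𝓣, ∀ n : EuclideanSpace ℝ (Fin 3), ‖n‖ = 1 →
      (∀ w ∈ fccSlots, ⟪G w, n⟫_ℝ = 0 ∨ ⟪G w, n⟫_ℝ = Real.sqrt (2 / 3) ∨ ⟪G w, n⟫_ℝ = -Real.sqrt (2 / 3)) →
      ⟪n, EuclideanSpace.single (2 : Fin 3) (1 : ℝ)⟫_ℝ ^ 2 < 1 →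
      δ₀ ≤ Real.sqrt 3 / 2 * Real.sqrt (1 - ⟪n, EuclideanSpace.single (2 : Fin 3) (1 : ℝ)⟫_ℝ ^ 2))
    (K : ℕ) (hK : h + 3 * R₀ + 3 ≤ K * δ₀) (hρK : (K : ℝ) + 23 ≤ ρ)
    (m : ℕ) (hm : 2 * (37 * (m : ℝ)) ^ 2 ≤ (ρ - 23 - K) ^ 2) :
    (2 * m + 1) ^ 2 ≤ (169 * K + 170) * (X.filter fun x => (X.filter fun q => dist x q = 1).card ≠ 12 ∧
      -R₀ - 2 ≤ x 2 ∧ x 2 ≤ h + R₀ + 4).card := by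
  set e₃ : EuclideanSpace ℝ (Fin 3) := EuclideanSpace.single (2 : Fin 3) (1 : ℝ) with he₃
  set PAY := X.filter fun x => (X.filter fun q => dist x q = 1).card ≠ 12 ∧ -R₀ - 2 ≤ x 2 ∧ x 2 ≤ h + R₀ + 4
    with hPAY
  set Gr : Finset (ℤ × ℤ) := Finset.Icc (-(m : ℤ)) m ×ˢ Finset.Icc (-(m : ℤ)) m with hGr
  have hGcard : Gr.card = (2 * m + 1) ^ 2 := by
    rw [hGr, Finset.card_product, Int.card_Icc]
    have : ((m : ℤ) + 1 - -(m : ℤ)).toNat = 2 * m + 1 := by omega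
    rw [this]; ring
  have hρ20 : (20 : ℝ) ≤ ρ := by have : (0 : ℝ) ≤ K := Nat.cast_nonneg K; linarith
  have hρK0 : (0 : ℝ) ≤ ρ - 23 - K := by linarith
  have he₃n : ‖e₃‖ = 1 := by rw [he₃, PiLp.norm_single, norm_one]
  -- heights of a ball equal or adjacent to another
  have hheight : ∀ y z : EuclideanSpace ℝ (Fin 3), (z = y ∨ dist y z = 1) → y 2 - 1 ≤ z 2 ∧ z 2 ≤ y 2 + 1 := by
    intro y z hyz
    rcases hyz with rfl | hd
    · exact ⟨by linarith, by linarith⟩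
    · have h := abs_apply_sub_le_dist z y 2
      rw [dist_comm] at h
      obtain ⟨h1, h2⟩ := abs_le.1 (h.trans hd.le)
      exact ⟨by linarith, by linarith⟩
  -- every axis of the grid has a payer, direct or by a plate climb
  have key : ∀ ij ∈ Gr, ∃ z : EuclideanSpace ℝ (Fin 3), z ∈ PAY ∧
      (((z 0 - 37 * (ij.1 : ℝ)) ^ 2 + (z 1 - 37 * (ij.2 : ℝ)) ^ 2 ≤ 18 ^ 2) ∨
       ∃ e : EuclideanSpace ℝ (Fin 3), (e 0 - 37 * (ij.1 : ℝ)) ^ 2 + (e 1 - 37 * (ij.2 : ℝ)) ^ 2 ≤ 17 ^ 2 ∧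
         ∃ d : EuclideanSpace ℝ (Fin 3), ∃ k : ℕ, k ≤ K ∧ ‖d‖ = 1 ∧ (∀ j : ℕ, j ≤ k → e + (j : ℝ) • d ∈ X) ∧
           (z = e + (k : ℝ) • d ∨ dist (e + (k : ℝ) • d) z = 1)) := by
    intro ij hij
    rw [hGr, Finset.mem_product, Finset.mem_Icc, Finset.mem_Icc] at hij
    obtain ⟨⟨hi1, hi2⟩, ⟨hj1, hj2⟩⟩ := hij
    have hi : ((ij.1 : ℝ)) ^ 2 ≤ (m : ℝ) ^ 2 := by
      have h1 : (-(m : ℝ)) ≤ (ij.1 : ℝ) := by exact_mod_cast hi1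
      have h2 : (ij.1 : ℝ) ≤ (m : ℝ) := by exact_mod_cast hi2
      nlinarith
    have hj : ((ij.2 : ℝ)) ^ 2 ≤ (m : ℝ) ^ 2 := by
      have h1 : (-(m : ℝ)) ≤ (ij.2 : ℝ) := by exact_mod_cast hj1
      have h2 : (ij.2 : ℝ) ≤ (m : ℝ) := by exact_mod_cast hj2
      nlinarith
    have hpK : (37 * (ij.1 : ℝ)) ^ 2 + (37 * (ij.2 : ℝ)) ^ 2 ≤ (ρ - 23 - K) ^ 2 := by nlinarith
    have hp : (37 * (ij.1 : ℝ)) ^ 2 + (37 * (ij.2 : ℝ)) ^ 2 ≤ (ρ - 20) ^ 2 :=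
      hpK.trans (by nlinarith)
    rcases tube_chain_sf hg hc X hX A₁ t₁ A₂ t₂ P₁ P₂ R₀ h ρ hR₀ hρ hρ20 hh hP₁X hP₂X hcell hP₁ hP₂ 𝓣 hA₁ hT
        (37 * (ij.1 : ℝ)) (37 * (ij.2 : ℝ)) hp with
      ⟨z, hz, hdeg, hzh, hz1, hz2⟩ | ⟨e, he, G, hG, n, hn, hmenu, ⟨G', hG'T, hG'⟩, hown, hfar, her, he1, he2⟩
    · refine ⟨z, ?_, Or.inl hzh⟩
      rw [hPAY, mem_filter]
      exact ⟨hz, by omega, hz1, by linarith⟩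
    · -- the terminal twin dozen: frame not the top lattice, normal tilted
      have hGne : G '' fccStacking 1 (Real.sqrt (2 / 3)) ≠ A₂ '' fccStacking 1 (Real.sqrt (2 / 3)) :=
        fun hEq => hG (hT G hEq)
      have hmenu' : ∀ w ∈ fccSlots, ⟪G' w, n⟫_ℝ = 0 ∨ ⟪G' w, n⟫_ℝ = Real.sqrt (2 / 3) ∨
          ⟪G' w, n⟫_ℝ = -Real.sqrt (2 / 3) := by
        intro w hw
        have e1 : ⟪G' w, n⟫_ℝ = -⟪G w, n⟫_ℝ := by
          rw [hG' w, inner_sub_left, real_inner_smul_left, real_inner_self_eq_norm_sq, hn]; ring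
        rw [e1]
        rcases hmenu w hw with h0 | h0 | h0 <;> rw [h0]
        · left; ring
        · right; right; rfl
        · right; left; ring
      have htilt : ⟪n, e₃⟫_ℝ ^ 2 < 1 := by
        have hle : ⟪n, e₃⟫_ℝ ^ 2 ≤ 1 := by
          have h1 := abs_real_inner_le_norm n e₃
          rw [hn, he₃n, one_mul] at h1
          have h2 := abs_le.1 h1
          nlinarith
        rcases lt_or_eq_of_le hle with hlt | heq
        · exact hlt
        · exfalso
          apply hG
          refine hTh G' hG'T n hn heq hmenu' G fun x => ?_
          have e1 : ⟪G' x, n⟫_ℝ = -⟪G x, n⟫_ℝ := by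
            rw [hG' x, inner_sub_left, real_inner_smul_left, real_inner_self_eq_norm_sq, hn]; ring
          rw [e1, hG' x, mul_neg, neg_smul, sub_neg_eq_add, sub_add_cancel]
      have hδ' := hδ G' hG'T n hn hmenu' htilt
      have hK' : h + R₀ + 2 - e 2 ≤ K * δ₀ := by linarith
      have her' : e 0 ^ 2 + e 1 ^ 2 ≤ (ρ - K - 3) ^ 2 := by
        have := sq2_add_le hρK0 (by norm_num : (0 : ℝ) ≤ 17) hpK her
        have e0 : e 0 = 37 * (ij.1 : ℝ) + (e 0 - 37 * (ij.1 : ℝ)) := by ring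
        have e1 : e 1 = 37 * (ij.2 : ℝ) + (e 1 - 37 * (ij.2 : ℝ)) := by ring
        rw [e0, e1]
        exact this.trans (by nlinarith)
      obtain ⟨d, hd1, k, hk, hballs, z, hz, hdeg, hzalt, hzlo, hzhi⟩ :=
        twinDozen_plateClimb_payer hg hc A₂ t₂ X P₂ R₀ h ρ hR₀ hρ hX hP₂X hcell hP₂ G hGne hn hmenu hδ₀ hδ'
          he he2 hown hfar K hK' her' (by linarith)
      refine ⟨z, ?_, Or.inr ⟨e, her, d, k, hk, hd1, hballs, hzalt⟩⟩
      rw [hPAY, mem_filter]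
      obtain ⟨hl, hu⟩ := hheight _ _ hzalt
      exact ⟨hz, hdeg, by linarith, by linarith⟩
  choose! f hfP hfalt using key
  -- the fibres of `f`
  have fib : ∀ z : EuclideanSpace ℝ (Fin 3), (Gr.filter fun ij => f ij = z).card ≤ 169 * K + 170 := by
    intro z
    set S := Gr.filter fun ij => f ij = z with hS
    set Sd := S.filter fun ij => (z 0 - 37 * (ij.1 : ℝ)) ^ 2 + (z 1 - 37 * (ij.2 : ℝ)) ^ 2 ≤ 18 ^ 2 with hSd
    set Sc := S.filter fun ij => ¬ (z 0 - 37 * (ij.1 : ℝ)) ^ 2 + (z 1 - 37 * (ij.2 : ℝ)) ^ 2 ≤ 18 ^ 2 with hSc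
    have hsplit : Sd.card + Sc.card = S.card := card_filter_add_card_filter_not _
    -- direct payers determine their axis
    have hSd : Sd.card ≤ 1 := by
      refine Finset.card_le_one.2 fun ij hij ij' hij' => ?_
      rw [hSd, mem_filter] at hij hij'
      exact grid37_axis_unique z ij ij' hij.2 hij'.2
    -- climb payers: the data
    have keyc : ∀ ij ∈ Sc, ∃ e : EuclideanSpace ℝ (Fin 3), (e 0 - 37 * (ij.1 : ℝ)) ^ 2 + (e 1 - 37 * (ij.2 : ℝ)) ^ 2 ≤ 17 ^ 2 ∧
        ∃ d : EuclideanSpace ℝ (Fin 3), ∃ k : ℕ, k ≤ K ∧ ‖d‖ = 1 ∧ (∀ j : ℕ, j ≤ k → e + (j : ℝ) • d ∈ X) ∧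
          (z = e + (k : ℝ) • d ∨ dist (e + (k : ℝ) • d) z = 1) := by
      intro ij hij
      rw [hSc, mem_filter, hS, mem_filter] at hij
      obtain ⟨⟨hG, hfz⟩, hnot⟩ := hij
      rcases hfalt ij hG with hdir | hcl
      · rw [hfz] at hdir; exact absurd hdir hnot
      · rw [hfz] at hcl; exact hcl
    choose! ee hee dd kk hkk hdd hballs hzz using keyc
    -- the injection `ij ↦ (⟨y⋆, y'⟩, k)`
    set N₁ := X.filter fun y => y = z ∨ dist z y = 1 with hN₁
    set Tgt := (N₁.sigma fun y => X.filter fun y' => y' = y ∨ dist y y' = 1) ×ˢ Finset.range (K + 1) with hTgt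
    set φ : ℤ × ℤ → (Σ _ : EuclideanSpace ℝ (Fin 3), EuclideanSpace ℝ (Fin 3)) × ℕ := fun ij =>
      (⟨ee ij + (kk ij : ℝ) • dd ij, ee ij + ((kk ij - 1 : ℕ) : ℝ) • dd ij⟩, kk ij) with hφ
    have hTcard : Tgt.card ≤ 169 * (K + 1) := by
      rw [hTgt, card_product, card_range, Finset.card_sigma]
      have h1 : ∑ y ∈ N₁, (X.filter fun y' => y' = y ∨ dist y y' = 1).card ≤ ∑ _y ∈ N₁, 13 :=
        sum_le_sum fun y _ => card_filter_eq_or_dist_eq_one_le X hX y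
      rw [sum_const, smul_eq_mul] at h1
      have h2 : N₁.card ≤ 13 := card_filter_eq_or_dist_eq_one_le X hX z
      have : N₁.card * 13 ≤ 13 * 13 := by nlinarith
      exact Nat.mul_le_mul_right _ (h1.trans (this.trans (by norm_num)))
    have hstep : ∀ ij ∈ Sc, 0 < kk ij →
        ee ij + ((kk ij : ℕ) : ℝ) • dd ij - (ee ij + ((kk ij - 1 : ℕ) : ℝ) • dd ij) = dd ij := by
      intro ij _ hpos
      have : ((kk ij : ℕ) : ℝ) = ((kk ij - 1 : ℕ) : ℝ) + 1 := by
        rw [← Nat.cast_succ, Nat.succ_eq_add_one, Nat.sub_add_cancel hpos]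
      rw [this, add_smul, one_smul]; abel
    have hmaps : ∀ ij ∈ Sc, φ ij ∈ Tgt := by
      intro ij hij
      have hk := hkk ij hij
      have hb := hballs ij hij
      simp only [hφ, hTgt, mem_product, Finset.mem_sigma, mem_range]
      refine ⟨⟨?_, ?_⟩, by omega⟩
      · rw [hN₁, mem_filter]
        refine ⟨hb _ le_rfl, ?_⟩
        rcases hzz ij hij with h0 | h0
        · exact Or.inl h0.symm
        · rw [dist_comm]; exact Or.inr h0
      · rw [mem_filter]
        refine ⟨hb _ (Nat.sub_le _ _), ?_⟩
        rcases Nat.eq_zero_or_pos (kk ij) with h0 | hpos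
        · left; rw [h0]
        · right
          rw [dist_eq_norm, hstep ij hij hpos, hdd ij hij]
    have hrecon : ∀ ij ∈ Sc, ee ij = (ee ij + (kk ij : ℝ) • dd ij) -
        (kk ij : ℝ) • ((ee ij + (kk ij : ℝ) • dd ij) - (ee ij + ((kk ij - 1 : ℕ) : ℝ) • dd ij)) := by
      intro ij hij
      rcases Nat.eq_zero_or_pos (kk ij) with h0 | hpos
      · rw [h0]; simp
      · rw [hstep ij hij hpos, add_sub_cancel_right]
    have hinj : Set.InjOn φ ↑Sc := by
      intro ij hij ij' hij' hφeq
      simp only [hφ, Prod.mk.injEq, Sigma.mk.inj_iff, heq_eq_eq] at hφeq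
      obtain ⟨⟨h1, h2⟩, h3⟩ := hφeq
      have hee' : ee ij = ee ij' := by
        rw [hrecon ij hij, hrecon ij' hij', h1, h2, h3]
      have ha := hee ij hij
      have hb := hee ij' hij'
      rw [hee'] at ha
      exact grid37_axis_unique (ee ij') ij ij' (ha.trans (by norm_num)) (hb.trans (by norm_num))
    have hSc : Sc.card ≤ 169 * (K + 1) :=
      (Finset.card_le_card_of_injOn φ hmaps hinj).trans hTcard
    have : S.card ≤ 1 + 169 * (K + 1) := by rw [← hsplit]; exact Nat.add_le_add hSd hSc
    linarith
  -- assemble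
  have himg : Gr.image f ⊆ PAY := by
    intro z hz
    obtain ⟨ij, hij, rfl⟩ := mem_image.1 hz
    exact hfP ij hij
  have h1 : Gr.card ≤ (169 * K + 170) * (Gr.image f).card :=
    Finset.card_le_mul_card_image Gr _ fun z _ => fib z
  rw [← hGcard]
  exact h1.trans (Nat.mul_le_mul_left _ (card_le_card himg))

end Summit.Ventures.Crystal3D.Theorems

end
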